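import Literature.AnabelianGeometry.AbsoluteAnabelian.AbsTopICuspInertiaOfPSCRamification
import Literature.AnabelianGeometry.AbsoluteAnabelian.AbsTopICuspInertiaOfPSCEncoding
import HarnessLib

/-!
# [AbsTopI] Lemma 4.5 (iv) [amended] at `ofPSC`: the assembly B2 ∧ B3 ∧ B4 ⇒ B5, INSTANTIATED

abc-iut cell, layer L4, sub-DAG `plan/L4/SUBDAG-AbsTopI-Lem45.md`.  S. Mochizuki, *Topics in Absolute
Anabelian Geometry I* [AbsTopI], Lemma 4.5 (iv) p. 54 (lit key `paper:url-11ac98ba15fc`), as AMENDED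
by [IUTchI] Remark 1.2.2 (i)(ii) p. 40: "the decomposition groups of cusps `⊆ H_*` may be
characterized ["group-theoretically"] as the maximal closed subgroups `I ⊆ H_*` isomorphic to `ℤ_l`
which satisfy the following condition …" — typed by abc-iut-L4-t4 as the predicate
`IsMaximalCuspidalCandidate l d` (`AbsTopIChains.lean`) and, as the sub-DAG's row B5, as
`CuspInertiaData.Lem45ivCharacterisation l d` (`AbsTopICuspidalDecompositionSub.lean`).

This PROOF-ONLY file assembles, for the cusp-inertia data `CuspInertiaData.ofPSC G` of a pro-`{l}` PSC
datum `G : SemiGraphs.PSCDatum H_*` on a profinite `H_*` with at least one cusp, the three landed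
pieces — B3 PROVED (`CuspInertiaData.totRamIffCount_ofPSC`, this seat, p416137), B4 relative to layer
L3's NAMED `PSCDatum.CuspidalEdgeLikeCharacterization` (= [IUTchI] Rmk 1.2.3 (iv); abc-iut-w5-d062 /
abc-iut-L4-t6, encoding lemma discharged, p416704) and abc-iut-w5-d062's general implication
`lem45ivOfSubnodes_holds` (B2 ∧ B3 ∧ B4 ⇒ B5, p414615) — into the NODE STATEMENT of Lemma 4.5 (iv) at
`ofPSC G`: `CuspInertiaData.lem45ivCharacterisation_ofPSC`.  What remains an INPUT is exactly print's:
the cusp-count dictionary B2 "`r(V) = d(V) + 1`" (= Lemma 4.5 (iii), third sentence, whose own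
inputs are the [CombGC] §2 weight facts A3/A7/A9) and layer L3's named characterisation.

HONEST FRAMING: refereed pre-IUT anabelian group theory; a composition of kernel theorems of the
tree; nothing here bears on [IUTchIII] Cor 3.12; typed ≠ proved elsewhere.
-/

noncomputable section

namespace Literature.AnabelianGeometry.AbsoluteAnabelian.FundamentalExtension

open Literature.AnabelianGeometry.SemiGraphs

universe u

variable {Hstar : Type u} [Group Hstar] [TopologicalSpace Hstar] [IsTopologicalGroup Hstar]
  [CompactSpace Hstar] [T2Space Hstar] [TotallyDisconnectedSpace Hstar] (G : PSCDatum Hstar)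

/-- **[AbsTopI] Lemma 4.5 (iv) [amended] at `ofPSC G`** (sub-DAG row B5 INSTANTIATED): for a
pro-`{l}` PSC datum `G` on a profinite `H_*` with at least one cusp ("`X` is not proper"), GIVEN the
cusp-count dictionary `r = d + 1` on open subgroups (row B2 = Lemma 4.5 (iii), third sentence) and
layer L3's named characterisation of cuspidal edge-like subgroups ([IUTchI] Rmk 1.2.3 (iv)), the cusp
inertia subgroups of `H_*` are EXACTLY the maximal closed `I ≅ ℤ_l` satisfying abc-iut-L4-t4's
amended cuspidal criterion `d(I^l·J) + 1 < l·(d(I·J) + 1)`: `I ∈ inertiaSet ↔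
IsMaximalCuspidalCandidate l d I`. [cite: MochizukiAbsTopI2012, Lemma 4.5 (iv) p.54]
[cite: Mochizuki2012, IUTchI Rmk 1.2.2 (ii) p.40] -/
theorem CuspInertiaData.lem45ivCharacterisation_ofPSC {l : ℕ} (hS : G.Sigma = {l})
    (hC : Nonempty G.graph.C) (h : G.CuspidalEdgeLikeCharacterization) (d : CuspCountData Hstar)
    (hd : CuspCountDictionary d (CuspInertiaData.ofPSC G).r) :
    (CuspInertiaData.ofPSC G).Lem45ivCharacterisation l d :=
  lem45ivOfSubnodes_holds (CuspInertiaData.ofPSC G) l d hd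
    (CuspInertiaData.totRamIffCount_ofPSC G hS)
    (CuspInertiaData.inertiaIffMaximalTotRam_ofPSC_of_cuspidalEdgeLikeCharacterization G hS hC h)

/-- The same with the dictionary phrased through layer L3's `cuspCount` ("`r(G_V)`" = the
double-coset count): `∀ V open, G.cuspCount V = d.d V + 1`.
[cite: MochizukiAbsTopI2012, Lemma 4.5 (iii)(iv) p.54] -/
theorem CuspInertiaData.mem_inertiaSet_ofPSC_iff_isMaximalCuspidalCandidate {l : ℕ}
    (hS : G.Sigma = {l}) (hC : Nonempty G.graph.C) (h : G.CuspidalEdgeLikeCharacterization)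
    (d : CuspCountData Hstar)
    (hd : ∀ V : Subgroup Hstar, IsOpen (V : Set Hstar) → G.cuspCount V = d.d V + 1)
    (I : Subgroup Hstar) :
    I ∈ (CuspInertiaData.ofPSC G).inertiaSet ↔ IsMaximalCuspidalCandidate l d I :=
  CuspInertiaData.lem45ivCharacterisation_ofPSC G hS hC h d (fun V hV => hd V hV) I

/-- Consequently layer L3's CUSPIDAL subgroups of `Π_G = H_*` (the conjugates `γ • Π_c`) are exactly
the maximal cuspidal candidates of the amended Lemma 4.5 (iv) — the L3↔L4 dictionary in its final
form. [cite: MochizukiAbsTopI2012, Lemma 4.5 (iv) p.54] [cite: MochizukiCombGC2007, Def 1.1(ii) p.6] -/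
theorem CuspInertiaData.isCuspidal_iff_isMaximalCuspidalCandidate {l : ℕ}
    (hS : G.Sigma = {l}) (hC : Nonempty G.graph.C) (h : G.CuspidalEdgeLikeCharacterization)
    (d : CuspCountData Hstar)
    (hd : ∀ V : Subgroup Hstar, IsOpen (V : Set Hstar) → G.cuspCount V = d.d V + 1)
    (I : Subgroup Hstar) :
    G.IsCuspidal I ↔ IsMaximalCuspidalCandidate l d I := by
  rw [← CuspInertiaData.mem_inertiaSet_ofPSC_iff,
    CuspInertiaData.mem_inertiaSet_ofPSC_iff_isMaximalCuspidalCandidate G hS hC h d hd]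

end Literature.AnabelianGeometry.AbsoluteAnabelian.FundamentalExtension

end
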